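/-
Origin: expansion seat `planner-pub-hodgecm-pv06-0`, handover (3) 2026-08-18T04:03:42Z (latest in place at cutoff) (`HOME/pub-hodgecm-pv06/lean/Pv06/PerL34/ApproxIdentity.lean`, md5 7b4f0450, 196 lines);
landed by the gen-5 packager in gate run 21 as `HodgeCM/PerL34/ApproxIdentity.lean` (import ^import Pv[0-9]+\.PerL34\.→import HodgeCM.PerL34. ×1).
-/
/-
  pub-hodgecm — DAG node N23c (PerL v5 Prop. 3.6 Step 2), KERNEL SUPPLEMENT 2 (pv06):
  the approximate-identity operators `R(f_n)` of a strongly continuous bounded representation,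
  in Mathlib generality — the content of the `[SETUP D7]` fields `sm`, `sm_tendsto`, `sm_mem` of
  `HodgeCM.PerL34.Annihilation.AnnihilationDatum` (landed run 19) and of tex l. 392–393 / l. 423
  ("smooth vectors are dense"; print: Getz–Hahn, *An Introduction to Automorphic Representations*,
  GTM 300 (2024), §4.2, Prop. 4.2.3).

  For a topological group `G` with a measure `μ` finite on compacts, a complex Hilbert space `H` and a
  homomorphism `R : G →* (H →L[ℂ] H)` with `‖R g‖ ≤ c` and `g ↦ R g v` continuous for every `v`:
  * `smOp R … f … : H →L[ℂ] H`, `v ↦ ∫ f(g) • R g v dμ(g)` for a real test function `f ∈ C_c(G)`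
    (`smOp_apply`), with `‖smOp f‖ ≤ (∫ |f|) · c`;
  * `smOp_mem_of_invariant` — `R(f)` preserves every CLOSED `R(G)`-invariant subspace (the field `sm_mem`;
    proof: `M = Mᗮᗮ` and `⟪w, ∫ F⟫ = ∫ ⟪w, F⟫`);
  * `IsApproxIdentity μ f` (`f n ≥ 0` continuous compactly supported, `∫ f n = 1`, supports eventually
    inside every neighbourhood of `1`) and `smOp_tendsto` — `R(f_n)v → v` for EVERY `v` (the field
    `sm_tendsto`; proof: `‖R(f_n)v - v‖ = ‖∫ f_n(g) • (R g v - v)‖ ≤ sup_{supp f_n} ‖R g v - v‖ → 0` by strong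
    continuity at `1`);
  * `exists_isApproxIdentity` — such a sequence EXISTS on every first-countable locally compact T₂ group
    with a measure positive on opens (Urysohn bumps of `Vanishing.exists_bump_subset`, normalised).
  The remaining `[SETUP D7]` field `sm_cont` ("`R(f_n)v` is a continuous function on `[U(W)]`") is a
  property of the function model `H = L²([U(W)])` and is not addressed here.

  Imports `Pv06.PerL34.Vanishing` (↦ `HodgeCM.PerL34.Vanishing` on landing) only.  Nothing posited.
-/
import Summits.HodgeConjecture.HodgeCM.PerL34.Vanishing

open MeasureTheory Filter Topology
open scoped InnerProductSpace

noncomputable section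

namespace HodgeCM.PerL34.ApproxIdentity

variable {G : Type*} [Group G] [TopologicalSpace G] [MeasurableSpace G] [OpensMeasurableSpace G]
variable (μ : Measure G) [IsFiniteMeasureOnCompacts μ]
variable {H : Type*} [NormedAddCommGroup H] [InnerProductSpace ℂ H] [CompleteSpace H]

/-! ## The operators `R(f) = ∫ f(g) R(g) dμ(g)` -/
section Operators

variable (R : G →* (H →L[ℂ] H)) (hRc : ∀ v : H, Continuous fun g => R g v)
  (c : ℝ) (hRb : ∀ g, ‖R g‖ ≤ c)
  (f : G → ℝ) (hf : Continuous f) (hfs : HasCompactSupport f)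

omit [CompleteSpace H] in
include hRc hf hfs in
/-- (Ported verbatim from the HodgeCMPerL package; no docstring in the source.) -/
theorem integrable_smul_apply (v : H) :
    Integrable (fun g => (f g : ℂ) • R g v) μ := by
  refine ((Complex.continuous_ofReal.comp hf).smul (hRc v)).integrable_of_hasCompactSupport ?_
  exact HasCompactSupport.intro' hfs.isCompact (isClosed_tsupport _) fun x hx => by
    simp [image_eq_zero_of_notMem_tsupport hx]

omit [Group G] in
include hf hfs in
/-- (Ported verbatim from the HodgeCMPerL package; no docstring in the source.) -/
theorem integrable_abs : Integrable (fun g => |f g|) μ :=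
  (hf.integrable_of_hasCompactSupport hfs).abs

/-- `R(f) v = ∫ f(g) • R g v dμ(g)` as a bounded operator (`‖R(f)‖ ≤ (∫|f|)·c`). -/
def smOp : H →L[ℂ] H :=
  LinearMap.mkContinuous
    { toFun := fun v => ∫ g, (f g : ℂ) • R g v ∂μ
      map_add' := fun v w => by
        simp only [map_add, smul_add]
        exact integral_add (integrable_smul_apply μ R hRc f hf hfs v)
          (integrable_smul_apply μ R hRc f hf hfs w)
      map_smul' := fun a v => by
        simp only [map_smul, RingHom.id_apply]
        rw [← integral_smul]
        congr 1
        funext g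
        rw [smul_comm] }
    ((∫ g, |f g| ∂μ) * c) fun v => by
      simp only [LinearMap.coe_mk, AddHom.coe_mk]
      calc ‖∫ g, (f g : ℂ) • R g v ∂μ‖
          ≤ ∫ g, |f g| * (c * ‖v‖) ∂μ := by
            refine norm_integral_le_of_norm_le ((integrable_abs μ f hf hfs).mul_const _)
              (ae_of_all _ fun g => ?_)
            rw [norm_smul, Complex.norm_real, Real.norm_eq_abs]
            exact mul_le_mul_of_nonneg_left ((R g).le_of_opNorm_le (hRb g) v) (abs_nonneg _)
        _ = (∫ g, |f g| ∂μ) * c * ‖v‖ := by rw [integral_mul_const]; ring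

omit [CompleteSpace H] in
/-- (Ported verbatim from the HodgeCMPerL package; no docstring in the source.) -/
theorem smOp_apply (v : H) :
    smOp μ R hRc c hRb f hf hfs v = ∫ g, (f g : ℂ) • R g v ∂μ := rfl

/-- **`sm_mem`.**  `R(f)` preserves every closed `R(G)`-invariant subspace. -/
theorem smOp_mem_of_invariant (M : Submodule ℂ H) (hM : IsClosed (M : Set H))
    (hinv : ∀ (g : G), ∀ v ∈ M, R g v ∈ M) {v : H} (hv : v ∈ M) :
    smOp μ R hRc c hRb f hf hfs v ∈ M := by
  haveI : CompleteSpace M := hM.isComplete.completeSpace_coe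
  rw [← Submodule.orthogonal_orthogonal M, Submodule.mem_orthogonal]
  intro w hw
  rw [smOp_apply, ← integral_inner (integrable_smul_apply μ R hRc f hf hfs v) w]
  have h0 : ∀ g, ⟪w, (f g : ℂ) • R g v⟫_ℂ = 0 := fun g =>
    Submodule.inner_left_of_mem_orthogonal (M.smul_mem _ (hinv g v hv)) hw
  simp only [h0, integral_zero]

end Operators

/-! ## Approximate identities and `R(f_n)v → v` -/
section Approx

/-- An approximate identity (Dirac sequence) at `1 ∈ G` of real test functions. -/
structure IsApproxIdentity (f : ℕ → G → ℝ) : Prop where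
  cont : ∀ n, Continuous (f n)
  cpt : ∀ n, HasCompactSupport (f n)
  nonneg : ∀ n g, 0 ≤ f n g
  integral_one : ∀ n, ∫ g, f n g ∂μ = 1
  small : ∀ U ∈ 𝓝 (1 : G), ∀ᶠ n in atTop, Function.support (f n) ⊆ U

variable (R : G →* (H →L[ℂ] H)) (hRc : ∀ v : H, Continuous fun g => R g v)
  (c : ℝ) (hRb : ∀ g, ‖R g‖ ≤ c)

/-- **`sm_tendsto`** (Getz–Hahn Prop. 4.2.3 in this generality): for an approximate identity `(f_n)`
and EVERY vector `v`, `R(f_n) v → v`. -/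
theorem smOp_tendsto {f : ℕ → G → ℝ} (hf : IsApproxIdentity μ f) (v : H) :
    Tendsto (fun n => smOp μ R hRc c hRb (f n) (hf.cont n) (hf.cpt n) v) atTop (𝓝 v) := by
  rw [Metric.tendsto_atTop]
  intro ε hε
  -- strong continuity at `1`
  have h1 : R 1 v = v := by simp
  have hcont : ContinuousAt (fun g => R g v) 1 := (hRc v).continuousAt
  have hU : {g : G | dist (R g v) v < ε / 2} ∈ 𝓝 (1 : G) := by
    have := Metric.tendsto_nhds.mp hcont (ε / 2) (half_pos hε)
    simp only [h1] at this
    exact this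
  obtain ⟨N, hN⟩ := eventually_atTop.mp (hf.small _ hU)
  refine ⟨N, fun n hn => ?_⟩
  have hsub := hN n hn
  -- `R(f_n)v - v = ∫ f_n(g) • (R g v - v)`
  have hint := integrable_smul_apply μ R hRc (f n) (hf.cont n) (hf.cpt n) v
  have hintc : Integrable (fun g => (f n g : ℂ) • v) μ := by
    refine ((Complex.continuous_ofReal.comp (hf.cont n)).smul continuous_const).integrable_of_hasCompactSupport ?_
    exact HasCompactSupport.intro' (hf.cpt n).isCompact (isClosed_tsupport _) fun x hx => by
      simp [image_eq_zero_of_notMem_tsupport hx]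
  have hone : ∫ g, (f n g : ℂ) ∂μ = 1 := by
    rw [integral_complex_ofReal, hf.integral_one n, Complex.ofReal_one]
  have hdiff : smOp μ R hRc c hRb (f n) (hf.cont n) (hf.cpt n) v - v =
      ∫ g, (f n g : ℂ) • (R g v - v) ∂μ := by
    simp only [smul_sub]
    rw [integral_sub hint hintc, integral_smul_const, hone, one_smul, smOp_apply]
  -- pointwise bound on the support
  have hpt : ∀ g, ‖(f n g : ℂ) • (R g v - v)‖ ≤ f n g * (ε / 2) := by
    intro g
    rw [norm_smul, Complex.norm_real, Real.norm_eq_abs, abs_of_nonneg (hf.nonneg n g)]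
    by_cases hg : f n g = 0
    · simp [hg]
    · have hgU : g ∈ {g : G | dist (R g v) v < ε / 2} := hsub (Function.mem_support.mpr hg)
      have : ‖R g v - v‖ < ε / 2 := by rw [← dist_eq_norm]; exact hgU
      exact mul_le_mul_of_nonneg_left this.le (hf.nonneg n g)
  calc dist (smOp μ R hRc c hRb (f n) (hf.cont n) (hf.cpt n) v) v
      = ‖∫ g, (f n g : ℂ) • (R g v - v) ∂μ‖ := by rw [dist_eq_norm, hdiff]
    _ ≤ ∫ g, f n g * (ε / 2) ∂μ :=
        norm_integral_le_of_norm_le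
          (((hf.cont n).integrable_of_hasCompactSupport (hf.cpt n)).mul_const _)
          (ae_of_all _ hpt)
    _ = ε / 2 := by rw [integral_mul_const, hf.integral_one n, one_mul]
    _ < ε := half_lt_self hε

end Approx

/-! ## Existence of approximate identities -/
section Existence

variable [LocallyCompactSpace G] [T2Space G] [FirstCountableTopology G] [μ.IsOpenPosMeasure]

/-- On a first-countable locally compact T₂ group with a measure finite on compacts and positive on
opens (e.g. a Haar measure), approximate identities exist. -/
theorem exists_isApproxIdentity : ∃ f : ℕ → G → ℝ, IsApproxIdentity μ f := by
  obtain ⟨u, hu⟩ := (𝓝 (1 : G)).exists_antitone_basis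
  -- a bump inside `interior (u n)`, normalised
  have hb : ∀ n, ∃ φ : G → ℝ, Continuous φ ∧ HasCompactSupport φ ∧ (∀ x, 0 ≤ φ x) ∧ φ 1 = 1 ∧
      Function.support φ ⊆ interior (u n) := fun n =>
    Vanishing.exists_bump_subset (1 : G) isOpen_interior
      (mem_interior_iff_mem_nhds.mpr (hu.mem n))
  choose φ hφc hφs hφ0 hφ1 hφu using hb
  have hpos : ∀ n, 0 < ∫ g, φ n g ∂μ := fun n =>
    (hφc n).integral_pos_of_hasCompactSupport_nonneg_nonzero (hφs n) (fun x => hφ0 n x)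
      (by rw [hφ1 n]; exact one_ne_zero)
  refine ⟨fun n g => φ n g / ∫ x, φ n x ∂μ, ⟨fun n => (hφc n).div_const _, fun n => ?_,
    fun n g => div_nonneg (hφ0 n g) (hpos n).le, fun n => ?_, fun U hU => ?_⟩⟩
  · exact HasCompactSupport.intro' (hφs n).isCompact (isClosed_tsupport _) fun x hx => by
      simp [image_eq_zero_of_notMem_tsupport hx]
  · rw [integral_div, div_self (hpos n).ne']
  · filter_upwards [hu.eventually_subset hU] with n hn
    intro g hg
    have hg' : φ n g ≠ 0 := by
      intro h0; exact hg (by simp [h0])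
    exact hn (interior_subset (hφu n (Function.mem_support.mpr hg')))

end Existence

end HodgeCM.PerL34.ApproxIdentity

end
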